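import Literature.NumberTheory.QuadraticFields.ThreeTorsionMean
import HarnessLib

/-!
# Davenport–Heilbronn with a local condition at `3` (Bhargava–Varma 2016, Cor. 4 and Lemma 37): named facts

Cite item `wi-29874` (crux line `mirror-unit-signature` of `stmt-QuantumAdvantage-2427`, stub
`stub_mirrorRankRare`). M. Bhargava, I. Varma, *The mean number of 3-torsion elements in the class groups
and ideal groups of quadratic orders*, Proc. LMS 112 (2016) = arXiv:1401.5875 (held corpus text
`paper:arxiv-1401.5875`, read: Cor. 4 p. 3–4 (chunk p0003–p0004), Lemma 37 and §5.4 (chunks p0021–p0022)).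

* `bv_threeTorsion_mean_localAtThree` (halves `.ramified`, `.unramified`) — **Corollary 4 (b)** for the
  two local specifications at the single prime `3`, `Σ₃ = {3 ramified}` and `Σ₃ = {3 unramified}` (all
  maximal rings at every other prime): "Suppose one restricts to just those quadratic fields satisfying any
  specified set of local conditions at any finite set of primes. Then, when these quadratic fields are
  ordered by their absolute discriminants: … (b) The average number of `3`-torsion elements in the class
  groups of such real quadratic fields is `4/3`." In the tree's shape of `bst_threeTorsion_mean.pos`:
  the ratio `Σ #Cl₃(D) / Σ 1` over the positive fundamental discriminants `0 < D < X` (`posFundDiscrs X`)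
  with `3 ∣ D`, resp. `3 ∤ D`, tends to `4/3` (`3 ∣ D ⟺ 3` ramified in `ℚ(√D)`, as `9 ∤ D` for fundamental
  `D`; `#Cl₃(D) = quadFieldThreeTorsion D`).
* `bv_count_posFundDiscrs_localAtThree` (halves) — **Lemma 37 (a)** ([Bhargava, mass formulae]; used in
  the proof of Cor. 4): "The number of real `Σ`-orders `𝒪` with `|Disc(𝒪)| < X` is asymptotically
  `½ · Π_p ((p−1)/p · Σ_{R ∈ Σ_p} 1/(Disc_p(R) · #Aut(R))) · X`", for the same two `Σ`: the counts
  `#{0 < D < X fundamental : 3 ∣ D}`, `#{… : 3 ∤ D}` are `c · X + o(X)` with `c > 0`, the constant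
  quantified EXISTENTIALLY (in print, with the maximal-ring local factors `Σ_R 1/(Disc₃(R)#Aut(R)) = 1/3`
  for the two ramified rings `ℤ₃[√3], ℤ₃[√3ε]` and `= 1` for `ℤ₃ ⊕ ℤ₃, ℤ₃[√ε]`, the constants are
  `(3/π²)·(1/4)` and `(3/π²)·(3/4)`; only `c > 0` is used downstream).

Not covered by the tree's `tt_threeTorsion_sum_progression` (Taniguchi–Thorne Thm 6 needs `(6a, m) = 1`)
nor by `bst_threeTorsion_mean` (no local condition). Also in print: Nakagawa–Horie 1988 (PAMS 104) for
`3`-rank densities with local conditions, Bhargava–Shankar–Tsimerman Thm 6 / §8.4.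

## References

* M. Bhargava, I. Varma, Proc. London Math. Soc. (3) 112 (2016) 235–266 = arXiv:1401.5875, Thm. 3,
  Cor. 4, Lemma 37, §5.4. [BhargavaVarma2016]
-/

noncomputable section

open Finset Filter
open scoped Topology

namespace Literature.NumberTheory.QuadraticFields

/-! ### The mean `4/3` under a local condition at `3` (Bhargava–Varma, Cor. 4 (b)) -/

/-- **Bhargava–Varma 2016, Corollary 4 (b), local condition at `3`** (as printed: "Suppose one restricts
to just those quadratic fields satisfying any specified set of local conditions at any finite set of
primes. Then … (b) The average number of `3`-torsion elements in the class groups of such real quadratic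
fields is `4/3`."), for `Σ₃ = {3 ramified} = {3 ∣ D}` (first conjunct) and `Σ₃ = {3 unramified} = {3 ∤ D}`
(second conjunct): along `X ∈ ℕ`, `Σ_{0<D<X, D ∈ Σ₃} #Cl₃(D) / #{0<D<X, D ∈ Σ₃} → 4/3`, sums over the
positive fundamental discriminants `posFundDiscrs X`, `#Cl₃(D) = quadFieldThreeTorsion D`.
[cite: BhargavaVarma2016, Cor. 4 (b)] -/
def bv_threeTorsion_mean_localAtThree : Prop :=
  Tendsto (fun X : ℕ =>
      (∑ D ∈ (posFundDiscrs X).filter (fun D => (3 : ℤ) ∣ D), (quadFieldThreeTorsion D : ℝ)) /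
        (((posFundDiscrs X).filter (fun D => (3 : ℤ) ∣ D)).card : ℝ))
    atTop (𝓝 (4 / 3)) ∧
  Tendsto (fun X : ℕ =>
      (∑ D ∈ (posFundDiscrs X).filter (fun D => ¬ (3 : ℤ) ∣ D), (quadFieldThreeTorsion D : ℝ)) /
        (((posFundDiscrs X).filter (fun D => ¬ (3 : ℤ) ∣ D)).card : ℝ))
    atTop (𝓝 (4 / 3))

/-- The ramified half of `bv_threeTorsion_mean_localAtThree`: mean `4/3` of `#Cl₃` over `0 < D < X`,
`3 ∣ D`. [cite: BhargavaVarma2016, Cor. 4 (b)] -/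
theorem bv_threeTorsion_mean_localAtThree.ramified (h : bv_threeTorsion_mean_localAtThree) :
    Tendsto (fun X : ℕ =>
      (∑ D ∈ (posFundDiscrs X).filter (fun D => (3 : ℤ) ∣ D), (quadFieldThreeTorsion D : ℝ)) /
        (((posFundDiscrs X).filter (fun D => (3 : ℤ) ∣ D)).card : ℝ))
    atTop (𝓝 (4 / 3)) :=
  h.1

/-- The unramified half of `bv_threeTorsion_mean_localAtThree`: mean `4/3` of `#Cl₃` over `0 < D < X`,
`3 ∤ D`. [cite: BhargavaVarma2016, Cor. 4 (b)] -/
theorem bv_threeTorsion_mean_localAtThree.unramified (h : bv_threeTorsion_mean_localAtThree) :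
    Tendsto (fun X : ℕ =>
      (∑ D ∈ (posFundDiscrs X).filter (fun D => ¬ (3 : ℤ) ∣ D), (quadFieldThreeTorsion D : ℝ)) /
        (((posFundDiscrs X).filter (fun D => ¬ (3 : ℤ) ∣ D)).card : ℝ))
    atTop (𝓝 (4 / 3)) :=
  h.2

/-! ### Positive density of the two families (Bhargava–Varma, Lemma 37 (a)) -/

/-- **Bhargava–Varma 2016, Lemma 37 (a), local condition at `3`** (as printed: "The number of real
`Σ`-orders `𝒪` with `|Disc(𝒪)| < X` is asymptotically `½ · Π_p ((p−1)/p · Σ_{R ∈ Σ_p} 1/(Disc_p(R) ·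
#Aut(R))) · X`", attributed to Bhargava's mass formulae), for the maximal-order families
`Σ₃ = {3 ramified}` (first conjunct) and `Σ₃ = {3 unramified}` (second): the number of positive fundamental
discriminants `0 < D < X` with `3 ∣ D`, resp. `3 ∤ D`, is `c · X + o(X)` for some `c > 0` (the constant —
in print the Euler product, here `(3/π²)·(1/4)` resp. `(3/π²)·(3/4)` — is quantified existentially).
[cite: BhargavaVarma2016, Lemma 37 (a)] -/
def bv_count_posFundDiscrs_localAtThree : Prop :=
  (∃ c : ℝ, 0 < c ∧ Tendsto (fun X : ℕ =>
      (((posFundDiscrs X).filter (fun D => (3 : ℤ) ∣ D)).card : ℝ) / (X : ℝ)) atTop (𝓝 c)) ∧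
  (∃ c : ℝ, 0 < c ∧ Tendsto (fun X : ℕ =>
      (((posFundDiscrs X).filter (fun D => ¬ (3 : ℤ) ∣ D)).card : ℝ) / (X : ℝ)) atTop (𝓝 c))

/-- The ramified half of `bv_count_posFundDiscrs_localAtThree`: `#{0<D<X fundamental : 3 ∣ D} ~ c X`,
`c > 0`. [cite: BhargavaVarma2016, Lemma 37 (a)] -/
theorem bv_count_posFundDiscrs_localAtThree.ramified (h : bv_count_posFundDiscrs_localAtThree) :
    ∃ c : ℝ, 0 < c ∧ Tendsto (fun X : ℕ =>
      (((posFundDiscrs X).filter (fun D => (3 : ℤ) ∣ D)).card : ℝ) / (X : ℝ)) atTop (𝓝 c) :=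
  h.1

/-- The unramified half of `bv_count_posFundDiscrs_localAtThree`: `#{0<D<X fundamental : 3 ∤ D} ~ c X`,
`c > 0`. [cite: BhargavaVarma2016, Lemma 37 (a)] -/
theorem bv_count_posFundDiscrs_localAtThree.unramified (h : bv_count_posFundDiscrs_localAtThree) :
    ∃ c : ℝ, 0 < c ∧ Tendsto (fun X : ℕ =>
      (((posFundDiscrs X).filter (fun D => ¬ (3 : ℤ) ∣ D)).card : ℝ) / (X : ℝ)) atTop (𝓝 c) :=
  h.2

/-- `12 ∈ posFundDiscrs 13` with `3 ∣ 12`: the ramified family is not empty (`12 = 4·3`, `3 ≡ 3 (mod 4)`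
squarefree). [folklore] -/
example : (12 : ℤ) ∈ (posFundDiscrs 13).filter (fun D => (3 : ℤ) ∣ D) := by
  rw [Finset.mem_filter, mem_posFundDiscrs]
  refine ⟨⟨by norm_num, Or.inr ⟨by norm_num, by norm_num, ?_⟩⟩, by norm_num⟩
  rw [show (12 : ℤ) / 4 = 3 by norm_num, ← Int.squarefree_natAbs]
  exact Nat.prime_three.prime.squarefree

/-- `5 ∈ posFundDiscrs 6` with `3 ∤ 5`: the unramified family is not empty. [folklore] -/
example : (5 : ℤ) ∈ (posFundDiscrs 6).filter (fun D => ¬ (3 : ℤ) ∣ D) := by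
  rw [Finset.mem_filter, mem_posFundDiscrs]
  refine ⟨⟨by norm_num, Or.inl ⟨by decide, ?_, by norm_num⟩⟩, by norm_num⟩
  rw [← Int.squarefree_natAbs]
  exact Nat.prime_five.prime.squarefree

end Literature.NumberTheory.QuadraticFields

end
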